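import Summits.CriticalPhenomena.PercolationContinuityZ3.Theorems.PercNearOneGluingNoHeavyLowerTailSahiGridPatternOrthantGrid

/-!
# `NoHeavyLowerTail` (crux stmt-CriticalPhenomena-4575), Sahi programme: **TWO INDEPENDENT SLOTS — the pattern inequality when two of the
# three up-sets live on complementary coordinate blocks, EVERY DIMENSION** (coefficientwise `E₃ ≥ 0` for an independent pair of increasing events)

Support file (seat `prim-sahi-p1`, generation 10; `--supports stmt-CriticalPhenomena-4575`).  Pure proofs, no definitions, no `sorry`,
standard axioms.  Vocabulary of `…SahiGridPattern{,SliceForm,Harris,Kleitman,TwoLayerTop}` (`Pd`, `sStarD`, `ind`, `TotDist`, `thirdPt`,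
the counting form `sStarD_counting`, coefficientwise Harris `sum_ind_totDist_le`) and of `…SahiGridPattern` for the grid form (`Xd`, `Ssym`, `pb`).

THE MATHEMATICS.  `P_d = [3]^d`; for `X, Y ⊆ P_d` let `N(X,Y) = #{(x,y) ∈ X × Y : x, y differ in every axis}` (totally distinct pairs) and
`M(A,B,C) = #` Latin triples `(x,y,z) ∈ A × B × C` (pairwise totally distinct, `x = thirdPt y z`).  The counting form of the pattern functional is
  `sStarD A B C = 2^{d+1}|A∩B∩C| − N(A,B∩C) − N(B,A∩C) − N(C,A∩B) + M(A,B,C)`     (`sStarD_counting`).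
**THEOREM (`sStarD_nonneg_of_indepSlots`, every `d`).**  Let `A, B, C ⊆ P_d` be up-sets and `J ⊆ [d]` a set of axes such that membership in `A`
depends only on the coordinates in `J` and membership in `B` only on the coordinates outside `J`.  Then `0 ≤ sStarD A B C`.
PROOF (three lines).  Coefficientwise Harris (`sum_ind_totDist_le`) gives `N(A,B∩C) ≤ 2^d|ABC|` and `N(B,A∩C) ≤ 2^d|ABC|`.  And `N(C,A∩B) ≤ M(A,B,C)`
(`sum_td_meet_le_latin`) by an INJECTION needing no up-set hypothesis: a totally distinct pair `(z, y)` with `z ∈ C`, `y ∈ A ∩ B` is sent to the Latin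
triple `(a, b, z)` with `b := (thirdPt y z on J, y off J) ∈ B` (it agrees with `y` off `J`) and `a := thirdPt b z = (y on J, thirdPt y z off J) ∈ A`
(it agrees with `y` on `J`); `(z, y) ↦ (b, z)` is a bijection of `P_d × P_d`.  Summing, `sStarD ≥ 0`.  ∎
At the measure level this is the folklore fact `E₃(1_A,1_B,1_C) = [μ(ABC) − μ(A)μ(BC)] + [μ(ABC) − μ(B)μ(AC)] ≥ 0` for INDEPENDENT increasing
`A, B` (`μ(AB) = μ(A)μ(B)`; in the tree on cubes: `SahiE3JuntaMeet.ED_sahiE3_nonneg_of_indep`); the content here is the COEFFICIENTWISE (Latin /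
every-profile) version on every grid, i.e. a new face of `PatternPos d` in every dimension, with slot permutations `sStarD_nonneg_of_indepSlots₁₃/₂₃`
and the grid forms `latticeE3_gridProd_nonneg_indepSlots` (`Z³E₃ ≥ 0` for every nonnegative product weight on `[K+1]^d` when the increasing event `A`
is measurable w.r.t. the axes in `J`, `B` w.r.t. the axes outside `J`, and `C` is an arbitrary increasing event) and `sahiE_three_indepSlots_nonneg`.
HONEST LABEL: a face of `PatternPos`; `PatternPos d` (`d ≥ 4`), Sahi's `C₃` and Kahn's conjecture remain OPEN; nothing here asserts them. [this work]
-/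

namespace Summit.CriticalPhenomena.PercolationContinuityZ3.Theorems.SahiGridPattern

open Finset Literature.Probability.LatticeModels Literature.Combinatorics.Sahi2008
open SahiGrid3 (ind)
open scoped BigOperators

variable {d K : ℕ}

/-! ### The re-pairing bijection -/

/-- In `[3]`: the third value of a pair of distinct values differs from the second one. [this work] -/
theorem neg_add_ne_of_ne : ∀ u v : Fin 3, u ≠ v → -(u + v) ≠ v := by decide

/-- In `[3]`: taking the third value twice against the same partner returns the original value. [this work] -/
theorem neg_neg_add_add : ∀ u v : Fin 3, -(-(u + v) + v) = u := by decide

/-- The mixed point `ψ_J(q,p) := (thirdPt q p on J, q off J)` satisfies `ψ_J(ψ_J(q,p), p) = q`. [this work] -/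
theorem mixThird_invol (J : Finset (Fin d)) (q p : Pd d) :
    (fun a => if a ∈ J then thirdPt (fun a' => if a' ∈ J then thirdPt q p a' else q a') p a
      else (fun a' => if a' ∈ J then thirdPt q p a' else q a') a) = q := by
  funext a
  by_cases ha : a ∈ J
  · simp only [ha, if_true]
    show -((if a ∈ J then thirdPt q p a else q a) + p a) = q a
    rw [if_pos ha]
    exact neg_neg_add_add (q a) (p a)
  · simp only [ha, if_false]

/-- **Pairs into Latin triples** (every `d`, no up-set hypothesis).  If `A` depends only on the axes in `J` and `B` only on the axes outside `J`,
then `N(C, A∩B) ≤ M(A,B,C)`: the number of totally distinct pairs `(z, y)` with `z ∈ C`, `y ∈ A ∩ B` is at most the number of Latin triples in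
`A × B × C` (written in the indicator form of `sStarD_counting`). [this work] -/
theorem sum_td_meet_le_latin (J : Finset (Fin d)) {A B : Finset (Pd d)} (C : Finset (Pd d))
    (hA : ∀ x y : Pd d, (∀ a ∈ J, x a = y a) → (x ∈ A ↔ y ∈ A))
    (hB : ∀ x y : Pd d, (∀ a ∉ J, x a = y a) → (x ∈ B ↔ y ∈ B)) :
    (∑ p, ∑ q, ind C p * ind A q * ind B q * (if TotDist p q = true then (1:ℤ) else 0)) ≤
      ∑ q, ∑ r, ind B q * ind C r * ind A (thirdPt q r) * (if TotDist q r = true then (1:ℤ) else 0) := by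
  classical
  -- `ψ q p = (thirdPt q p on J, q off J)`; the bijection `(p, q) ↦ (ψ q p, p)` of `P_d × P_d`
  let ψ : Pd d → Pd d → Pd d := fun q p a => if a ∈ J then thirdPt q p a else q a
  have hψ : ∀ q p : Pd d, ψ (ψ q p) p = q := fun q p => mixThird_invol J q p
  let e : Pd d × Pd d ≃ Pd d × Pd d :=
    { toFun := fun x => (ψ x.2 x.1, x.1)
      invFun := fun x => (x.2, ψ x.1 x.2)
      left_inv := fun x => Prod.ext rfl (hψ x.2 x.1)
      right_inv := fun x => Prod.ext (hψ x.1 x.2) rfl }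
  -- the values needed on the image: `ψ q p ∈ B`, `thirdPt (ψ q p) p ∈ A`, `ψ q p` totally distinct from `p`
  have memB : ∀ p q : Pd d, q ∈ B → ψ q p ∈ B := fun p q hq =>
    (hB (ψ q p) q fun a ha => by show (if a ∈ J then thirdPt q p a else q a) = q a; rw [if_neg ha]).2 hq
  have memA : ∀ p q : Pd d, q ∈ A → thirdPt (ψ q p) p ∈ A := fun p q hq =>
    (hA (thirdPt (ψ q p) p) q fun a ha => by
      show -((if a ∈ J then thirdPt q p a else q a) + p a) = q a
      rw [if_pos ha]
      exact neg_neg_add_add (q a) (p a)).2 hq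
  have tdψ : ∀ p q : Pd d, TotDist p q = true → TotDist (ψ q p) p = true := by
    intro p q h
    rw [totDist_iff] at h ⊢
    intro a
    by_cases ha : a ∈ J
    · show (if a ∈ J then thirdPt q p a else q a) ≠ p a
      rw [if_pos ha]
      exact neg_add_ne_of_ne (q a) (p a) (fun e => h a e.symm)
    · show (if a ∈ J then thirdPt q p a else q a) ≠ p a
      rw [if_neg ha]
      exact fun e => h a e.symm
  -- pointwise comparison along the bijection
  have hG : ∀ b z : Pd d, 0 ≤ ind B b * ind C z * ind A (thirdPt b z) * (if TotDist b z = true then (1:ℤ) else 0) :=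
    fun b z => mul_nonneg (mul_nonneg (mul_nonneg (ind_nonneg' _ _) (ind_nonneg' _ _)) (ind_nonneg' _ _))
      (by split_ifs <;> norm_num)
  have pt : ∀ p q : Pd d, ind C p * ind A q * ind B q * (if TotDist p q = true then (1:ℤ) else 0) ≤
      ind B (ψ q p) * ind C p * ind A (thirdPt (ψ q p) p) * (if TotDist (ψ q p) p = true then (1:ℤ) else 0) := by
    intro p q
    by_cases hp : p ∈ C
    · by_cases hqA : q ∈ A
      · by_cases hqB : q ∈ B
        · by_cases ht : TotDist p q = true
          · have h1 := memB p q hqB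
            have h2 := memA p q hqA
            have h3 := tdψ p q ht
            unfold ind
            rw [if_pos hp, if_pos hqA, if_pos hqB, if_pos ht, if_pos h1, if_pos h2, if_pos h3]
          · have e0 : (if TotDist p q = true then (1:ℤ) else 0) = 0 := if_neg ht
            have l0 : ind C p * ind A q * ind B q * (if TotDist p q = true then (1:ℤ) else 0) = 0 := by rw [e0, mul_zero]
            rw [l0]; exact hG _ _
        · have e0 : ind B q = 0 := if_neg hqB
          have l0 : ind C p * ind A q * ind B q * (if TotDist p q = true then (1:ℤ) else 0) = 0 := by rw [e0]; ring
          rw [l0]; exact hG _ _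
      · have e0 : ind A q = 0 := if_neg hqA
        have l0 : ind C p * ind A q * ind B q * (if TotDist p q = true then (1:ℤ) else 0) = 0 := by rw [e0]; ring
        rw [l0]; exact hG _ _
    · have e0 : ind C p = 0 := if_neg hp
      have l0 : ind C p * ind A q * ind B q * (if TotDist p q = true then (1:ℤ) else 0) = 0 := by rw [e0]; ring
      rw [l0]; exact hG _ _
  -- sum along the bijection
  calc (∑ p, ∑ q, ind C p * ind A q * ind B q * (if TotDist p q = true then (1:ℤ) else 0))
      = ∑ x : Pd d × Pd d, ind C x.1 * ind A x.2 * ind B x.2 * (if TotDist x.1 x.2 = true then (1:ℤ) else 0) :=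
        (Fintype.sum_prod_type' (fun p q : Pd d => ind C p * ind A q * ind B q *
          (if TotDist p q = true then (1:ℤ) else 0))).symm
    _ ≤ ∑ x : Pd d × Pd d, ind B (e x).1 * ind C (e x).2 * ind A (thirdPt (e x).1 (e x).2) *
          (if TotDist (e x).1 (e x).2 = true then (1:ℤ) else 0) := Finset.sum_le_sum fun x _ => pt x.1 x.2
    _ = ∑ x : Pd d × Pd d, ind B x.1 * ind C x.2 * ind A (thirdPt x.1 x.2) * (if TotDist x.1 x.2 = true then (1:ℤ) else 0) :=
        Equiv.sum_comp e (fun x : Pd d × Pd d => ind B x.1 * ind C x.2 * ind A (thirdPt x.1 x.2) *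
          (if TotDist x.1 x.2 = true then (1:ℤ) else 0))
    _ = ∑ q, ∑ r, ind B q * ind C r * ind A (thirdPt q r) * (if TotDist q r = true then (1:ℤ) else 0) :=
        Fintype.sum_prod_type' (fun q r : Pd d => ind B q * ind C r * ind A (thirdPt q r) *
          (if TotDist q r = true then (1:ℤ) else 0))

/-! ### The theorem -/

/-- **THE PATTERN INEQUALITY WITH TWO INDEPENDENT SLOTS, EVERY DIMENSION.**  If the up-set `A ⊆ [3]^d` depends only on the coordinates in `J`
and the up-set `B` only on the coordinates outside `J`, then `0 ≤ sStarD A B C` for EVERY up-set `C`.  (Coefficientwise form of `E₃ ≥ 0` for an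
independent pair of increasing events: Harris twice plus the injection `sum_td_meet_le_latin`.) [this work] -/
theorem sStarD_nonneg_of_indepSlots (J : Finset (Fin d)) {A B C : Finset (Pd d)} (hA : IsUpperSet (A : Set (Pd d)))
    (hB : IsUpperSet (B : Set (Pd d))) (hC : IsUpperSet (C : Set (Pd d)))
    (hAJ : ∀ x y : Pd d, (∀ a ∈ J, x a = y a) → (x ∈ A ↔ y ∈ A))
    (hBJ : ∀ x y : Pd d, (∀ a ∉ J, x a = y a) → (x ∈ B ↔ y ∈ B)) :
    0 ≤ sStarD A B C := by
  have hBC : IsUpperSet ((B ∩ C : Finset (Pd d)) : Set (Pd d)) := by rw [Finset.coe_inter]; exact hB.inter hC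
  have hAC : IsUpperSet ((A ∩ C : Finset (Pd d)) : Set (Pd d)) := by rw [Finset.coe_inter]; exact hA.inter hC
  -- Harris twice
  have H1 := sum_ind_totDist_le d A (B ∩ C) hA hBC
  have H2 := sum_ind_totDist_le d B (A ∩ C) hB hAC
  simp only [ind_inter_eq_mul] at H1 H2
  have e1 : (∑ p, ∑ q, ind A p * (ind B q * ind C q) * (if TotDist p q = true then (1:ℤ) else 0)) =
      ∑ p, ∑ q, ind A p * ind B q * ind C q * (if TotDist p q = true then (1:ℤ) else 0) :=
    Finset.sum_congr rfl fun p _ => Finset.sum_congr rfl fun q _ => by ring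
  have e1' : (∑ p, ind A p * (ind B p * ind C p)) = ∑ p, ind A p * ind B p * ind C p :=
    Finset.sum_congr rfl fun p _ => by ring
  have e2 : (∑ p, ∑ q, ind B p * (ind A q * ind C q) * (if TotDist p q = true then (1:ℤ) else 0)) =
      ∑ p, ∑ q, ind B p * ind A q * ind C q * (if TotDist p q = true then (1:ℤ) else 0) :=
    Finset.sum_congr rfl fun p _ => Finset.sum_congr rfl fun q _ => by ring
  have e2' : (∑ p, ind B p * (ind A p * ind C p)) = ∑ p, ind A p * ind B p * ind C p :=
    Finset.sum_congr rfl fun p _ => by ring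
  rw [e1, e1'] at H1
  rw [e2, e2'] at H2
  -- the injection
  have H3 := sum_td_meet_le_latin J C hAJ hBJ
  have h2d : (2:ℤ) * 2 ^ d * (∑ p, ind A p * ind B p * ind C p) = 2 ^ d * (∑ p, ind A p * ind B p * ind C p) +
      2 ^ d * (∑ p, ind A p * ind B p * ind C p) := by ring
  rw [sStarD_counting, h2d]
  linarith

/-- Slot-permuted form: the independent pair in slots `1, 3`. [this work] -/
theorem sStarD_nonneg_of_indepSlots₁₃ (J : Finset (Fin d)) {A B C : Finset (Pd d)} (hA : IsUpperSet (A : Set (Pd d)))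
    (hB : IsUpperSet (B : Set (Pd d))) (hC : IsUpperSet (C : Set (Pd d)))
    (hAJ : ∀ x y : Pd d, (∀ a ∈ J, x a = y a) → (x ∈ A ↔ y ∈ A))
    (hCJ : ∀ x y : Pd d, (∀ a ∉ J, x a = y a) → (x ∈ C ↔ y ∈ C)) :
    0 ≤ sStarD A B C := by
  rw [sStarD_swap23]; exact sStarD_nonneg_of_indepSlots J hA hC hB hAJ hCJ

/-- Slot-permuted form: the independent pair in slots `2, 3`. [this work] -/
theorem sStarD_nonneg_of_indepSlots₂₃ (J : Finset (Fin d)) {A B C : Finset (Pd d)} (hA : IsUpperSet (A : Set (Pd d)))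
    (hB : IsUpperSet (B : Set (Pd d))) (hC : IsUpperSet (C : Set (Pd d)))
    (hBJ : ∀ x y : Pd d, (∀ a ∈ J, x a = y a) → (x ∈ B ↔ y ∈ B))
    (hCJ : ∀ x y : Pd d, (∀ a ∉ J, x a = y a) → (x ∈ C ↔ y ∈ C)) :
    0 ≤ sStarD A B C := by
  rw [sStarD_swap12, sStarD_swap23]; exact sStarD_nonneg_of_indepSlots J hB hC hA hBJ hCJ

/-! ### Grid form: Sahi's `E₃ ≥ 0` for an independent pair of increasing events, coefficientwise, every grid -/

/-- **The symmetrised pattern value of (`J`-measurable up-set, `Jᶜ`-measurable up-set, up-set) is nonnegative** at every three-point sample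
`ω` of the grid `[K+1]^d`: the pull-backs along the sorted sample are up-sets of `[3]^d` measurable w.r.t. the same blocks. [this work] -/
theorem Ssym_nonneg_indepSlots (J : Finset (Fin d)) {A B C : Finset (Xd d K)} (hA : IsUpperSet (A : Set (Xd d K)))
    (hB : IsUpperSet (B : Set (Xd d K))) (hC : IsUpperSet (C : Set (Xd d K)))
    (hAJ : ∀ x y : Xd d K, (∀ a ∈ J, x a = y a) → (x ∈ A ↔ y ∈ A))
    (hBJ : ∀ x y : Xd d K, (∀ a ∉ J, x a = y a) → (x ∈ B ↔ y ∈ B)) (ω : Fin 3 → Xd d K) :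
    0 ≤ Ssym A B C ω := by
  let σ : Fin d → Equiv.Perm (Fin 3) := fun a => Tuple.sort fun c => ω c a
  have hsort : ∀ a, Monotone fun c => Tmap σ ω c a := fun a => by
    show Monotone ((fun c => ω c a) ∘ σ a)
    exact Tuple.monotone_sort _
  rw [← S_Tmap A B C σ ω, S_eq_sStarD]
  set ω' : Fin 3 → Xd d K := Tmap σ ω with hω'
  have hA' : ∀ p q : Pd d, (∀ a ∈ J, p a = q a) → (p ∈ pb ω' A ↔ q ∈ pb ω' A) := by
    intro p q hpq
    unfold pb
    rw [Finset.mem_filter, Finset.mem_filter]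
    simp only [Finset.mem_univ, true_and]
    refine hAJ _ _ fun a ha => ?_
    show ω' (p a) a = ω' (q a) a
    rw [hpq a ha]
  have hB' : ∀ p q : Pd d, (∀ a ∉ J, p a = q a) → (p ∈ pb ω' B ↔ q ∈ pb ω' B) := by
    intro p q hpq
    unfold pb
    rw [Finset.mem_filter, Finset.mem_filter]
    simp only [Finset.mem_univ, true_and]
    refine hBJ _ _ fun a ha => ?_
    show ω' (p a) a = ω' (q a) a
    rw [hpq a ha]
  exact sStarD_nonneg_of_indepSlots J (isUpperSet_pb hsort hA) (isUpperSet_pb hsort hB) (isUpperSet_pb hsort hC) hA' hB'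

/-- **SAHI'S `E₃ ≥ 0` FOR AN INDEPENDENT PAIR, COEFFICIENTWISE ON EVERY GRID, homogeneous form** (every `d`, `K`): for every nonnegative product
weight `w = ⊗_a g_a` on `[K+1]^d`, up-sets `A` (measurable w.r.t. the axes in `J`), `B` (w.r.t. the axes outside `J`) and an arbitrary up-set `C`:
`0 ≤ latticeE3 w A B C` (`= Z³·E₃(1_A,1_B,1_C)`). [this work] -/
theorem latticeE3_gridProd_nonneg_indepSlots (g : Fin d → Fin (K + 1) → ℝ) (hg : ∀ a u, 0 ≤ g a u) (J : Finset (Fin d))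
    {A B C : Finset (Xd d K)} (hA : IsUpperSet (A : Set (Xd d K))) (hB : IsUpperSet (B : Set (Xd d K)))
    (hC : IsUpperSet (C : Set (Xd d K))) (hAJ : ∀ x y : Xd d K, (∀ a ∈ J, x a = y a) → (x ∈ A ↔ y ∈ A))
    (hBJ : ∀ x y : Xd d K, (∀ a ∉ J, x a = y a) → (x ∈ B ↔ y ∈ B)) :
    0 ≤ latticeE3 (fun ω : Xd d K => ∏ a, g a (ω a)) A B C := by
  have hcard : (0 : ℝ) < Fintype.card (Fin d → Equiv.Perm (Fin 3)) := by exact_mod_cast Fintype.card_pos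
  have h := latticeE3_symm g A B C
  have hsum : 0 ≤ ∑ ω : Fin 3 → Xd d K, (∏ c, ∏ a, g a (ω c a)) * (Ssym A B C ω : ℝ) :=
    Finset.sum_nonneg fun ω _ => mul_nonneg (Finset.prod_nonneg fun c _ => Finset.prod_nonneg fun a _ => hg a _)
      (by exact_mod_cast Ssym_nonneg_indepSlots J hA hB hC hAJ hBJ ω)
  rw [← h] at hsum
  exact (mul_nonneg_iff_of_pos_left hcard).1 hsum

/-- **SAHI'S `E₃ ≥ 0` FOR AN INDEPENDENT PAIR ON EVERY GRID, probability form** (every `d`, `K`): for every product probability weight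
`w = ⊗ g_i` on `[K+1]^d`, increasing events `A` (measurable w.r.t. the axes in `J`) and `B` (w.r.t. the axes outside `J`) — in particular `A, B`
independent — and an arbitrary increasing event `C`: `0 ≤ E₃(1_A, 1_B, 1_C)`. [this work] -/
theorem sahiE_three_indepSlots_nonneg (g : Fin d → Fin (K + 1) → ℝ) (hg0 : ∀ i u, 0 ≤ g i u) (hg1 : ∀ i, ∑ u, g i u = 1)
    (J : Finset (Fin d)) {A B C : Finset (Xd d K)} (hA : IsUpperSet (A : Set (Xd d K))) (hB : IsUpperSet (B : Set (Xd d K)))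
    (hC : IsUpperSet (C : Set (Xd d K))) (hAJ : ∀ x y : Xd d K, (∀ a ∈ J, x a = y a) → (x ∈ A ↔ y ∈ A))
    (hBJ : ∀ x y : Xd d K, (∀ a ∉ J, x a = y a) → (x ∈ B ↔ y ∈ B)) :
    0 ≤ sahiE (fun ω : Xd d K => ∏ i, g i (ω i)) 3 ![setInd A, setInd B, setInd C] := by
  classical
  have hsum : ∑ ω : Fin d → Fin (K + 1), ∏ i, g i (ω i) = 1 := by
    rw [← Fintype.prod_sum]; simp [hg1]
  rw [sahiE_three_indicator_eq_latticeE3 hsum]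
  exact latticeE3_gridProd_nonneg_indepSlots g hg0 J hA hB hC hAJ hBJ

end Summit.CriticalPhenomena.PercolationContinuityZ3.Theorems.SahiGridPattern
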